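import Summits.QuantumFields.YangMills.Theorems.UnitScaleTiltProp7LineAvgSmoothBounds
import HarnessLib

/-!
# Route `UnitScaleTilt`, crux K1 child «MinimiserStabilityRegPr» (stmt-QuantumFields-19200), registered stub `stub_prop7From14` (skeleton birth_v6
# 636b1fa3b005; leaf V3 «Prop 7 from a background (14)») — sub-lemma V3-C″, part 3/3: **A `k`-UNIFORM RIGHT INVERSE OF THE STRAIGHT-LINE `k`-FOLD
# BLOCK AVERAGING `Q_k = LatticeFieldCalculus.bondAvgIter k` WITH BOTH BOUNDS OF [Balaban1985Variational] (46)** — sup `3·2^{d−1}`, `ℓ²` `18·4^{d−1}L^{kd}`,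
# GRADIENT-sup `90·2^{d−1}L^{−k}`, GRADIENT-`ℓ²` `8100·d·4^{d−1}L^{kd}L^{−2k}`; instance at the d = 3 carrier

Cell `ym3-torus` ∕ fleet seat `ym-ust-19200-p1` (gen 4).  Third file of the series (`…SmoothNormal`: the modulated tent field and `M_kZ = TW`; `…SmoothBounds`:
the four bounds for an admissible profile).  Here: §7 the bubble profile `ψ(s) = 6(s+1)(L^k − s)∕((L^k+1)(L^k+2))` is admissible — block sum `L^k`
(`bubble_sum`, from `6Σ_{s<n}(s+1)(n−s) = n(n+1)(n+2)`), `0 ≤ ψ ≤ 2`, `|ψ(s+1) − ψ(s)| ≤ 6L^{−k}`, `ψ(0), ψ(L^k−1) ≤ 6L^{−k}`; §8 the assembly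
`H = (modulated tent field) ∘ T⁻¹` with gen 3's tridiagonal `T` and its `k`-uniform dominance constant (`key_dominance`, `tridiag_sup_le`, `tridiag_l2_le`
reused as they stand): **`exists_smoothRightInverse_lineAvg`**, **`exists_smoothRightInverse_bondAvgIter`** (standing range `k ≤ m + K`),
**`exists_smoothRightInverse_bondAvgIter_T3`** (constants `12`, `288L^{3(K−n)}`, `360L^{−(K−n)}`, `388800L^{3(K−n)}L^{−2(K−n)}` at `d = 3`, uniform in `m, n, K`).

WHY (print, p. 285): the chart (47) `A = A′ − HD(A′)` of Sect. C rests on a right inverse `H` that «giv[es] a minimum of the quadratic form ½⟨A, ΔA⟩ under the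
restrictions L^jηQ_jA = B …», whence BOTH «|HB| ≤ B₀(L^jη)⁻¹|B|, |∇HB| ≤ B₀(L^jη)⁻²|B|» (46) by [Balaban1984PropagatorsII] Thm 3.12.  Gen 3's tent right inverse
(p503703) has the first bound only (it jumps by its own size across transverse block faces); the modulated one has both, with elementary constants, and
the same normal operator.  In the item's `ℓ²` uniqueness route this makes the Dirichlet energy of the secant–tangent correction `H(M_kY)` of order
`L^{k(d−2)}·Σ_c(M_kY)(c)²`, the scale the kernel coercivity can absorb.

HONEST SCOPE.  Flat background, straight-line main term, top scale; no Landau-type condition `RD^*HB = 0` on `HZ` (print's `H` has it); the true linearised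
(0.4)-averaging differs from `M_k` by the block-axial representative and comb terms (`BlockAveragingEMLLinearised`).  Nothing of Bałaban's is asserted.

References: T. Bałaban, CMP 102 (1985) 277–309 [Balaban1985Variational] ((45)–(47) p.285, p.287); CMP 96 (1984) 223–250 [Balaban1984PropagatorsII] (Thm 3.12);
CMP 95 (1984) 17–40 [Balaban1984PropagatorsI] ((1.18) p.20).
-/

noncomputable section

open scoped BigOperators

namespace Summit.QuantumFields.YangMills.Theorems.Prop7LineAvgSmoothRightInverse

open Literature.MathematicalPhysics.QuantumFieldTheory.Balaban1983to89
open Finset LatticeFieldCalculus B1RG242Torus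
open B10StarCount (sum_pbond shift_apply_self shift_apply_ne unshift_shift shiftEquiv)
open Summit.QuantumFields.YangMills.Theorems.Prop7FlatCoercivity (iterate_shift_eq_runSite runSite_runSite runSite_apply_self
  runSite_apply_of_ne fibreSite_runSite sum_fibre_eq_sum_offsets sum_shift)
open Summit.QuantumFields.YangMills.Theorems.Prop7LineAvgRightInverse

variable {P : Params} {k : ℕ}

/-! ## §7 The bubble profile `ψ(s) = 6(s+1)(n−s)∕((n+1)(n+2))`: block mean `1`, bounded by `2`, Lipschitz and face values `≤ 6∕n` -/

section Profile

/-- `6·Σ_{s<n} (s+1)(n−s) = n(n+1)(n+2)` (the bubble has block sum `n(n+1)(n+2)/6`). [folklore] -/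
theorem six_mul_sum_bubble (n : ℕ) : 6 * ∑ s ∈ range n, (((s : ℕ) : ℝ) + 1) * ((n : ℝ) - s) = (n : ℝ) * ((n : ℝ) + 1) * ((n : ℝ) + 2) := by
  -- Gauss: `Σ_{s<n} (s+1) = n(n+1)/2`
  have gauss : ∀ m : ℕ, ∑ s ∈ range m, (((s : ℕ) : ℝ) + 1) = (m : ℝ) * ((m : ℝ) + 1) / 2 := by
    intro m
    induction m with
    | zero => simp
    | succ m ih => rw [Finset.sum_range_succ, ih]; push_cast; ring
  induction n with
  | zero => simp
  | succ n ih =>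
    rw [Finset.sum_range_succ]
    have hre : ∀ s ∈ range n, (((s : ℕ) : ℝ) + 1) * (((n + 1 : ℕ) : ℝ) - s) = (((s : ℕ) : ℝ) + 1) * ((n : ℝ) - s) + (((s : ℕ) : ℝ) + 1) := by
      intro s _; push_cast; ring
    rw [Finset.sum_congr rfl hre, Finset.sum_add_distrib, gauss]
    have ih' : ∑ s ∈ range n, (((s : ℕ) : ℝ) + 1) * ((n : ℝ) - s) = (n : ℝ) * ((n : ℝ) + 1) * ((n : ℝ) + 2) / 6 := by linarith
    rw [ih']; push_cast; ring

variable (P k)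

/-- **BLOCK MEAN ONE**: `Σ_{s<L^k} ψ(s) = L^k` for the bubble profile. [folklore] -/
theorem bubble_sum :
    ∑ s : Fin (P.L ^ k), (6 * (((s : ℕ) : ℝ) + 1) * ((P.L : ℝ) ^ k - (s : ℕ)) / (((P.L : ℝ) ^ k + 1) * ((P.L : ℝ) ^ k + 2))) = (P.L : ℝ) ^ k := by
  have hN : (0 : ℝ) < (P.L : ℝ) ^ k := pow_pos (by exact_mod_cast P.L_pos) k
  rw [Fin.sum_univ_eq_sum_range (fun s => 6 * (((s : ℕ) : ℝ) + 1) * ((P.L : ℝ) ^ k - (s : ℕ)) / (((P.L : ℝ) ^ k + 1) * ((P.L : ℝ) ^ k + 2))) (P.L ^ k)]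
  have h6 := six_mul_sum_bubble (P.L ^ k)
  push_cast at h6
  simp only [← Finset.sum_div, Finset.mul_sum] at h6 ⊢
  rw [div_eq_iff (by positivity)]
  have : ∑ s ∈ range (P.L ^ k), 6 * (((s : ℕ) : ℝ) + 1) * ((P.L : ℝ) ^ k - (s : ℕ)) = ∑ s ∈ range (P.L ^ k), 6 * ((((s : ℕ) : ℝ) + 1) * ((P.L : ℝ) ^ k - (s : ℕ))) :=
    Finset.sum_congr rfl fun s _ => by ring
  rw [this, h6]; ring

/-- `0 ≤ ψ(s)` for `s < L^k`. [folklore] -/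
theorem bubble_nonneg (s : ℕ) (hs : s < P.L ^ k) :
    0 ≤ 6 * (((s : ℕ) : ℝ) + 1) * ((P.L : ℝ) ^ k - (s : ℕ)) / (((P.L : ℝ) ^ k + 1) * ((P.L : ℝ) ^ k + 2)) := by
  have hN : (0 : ℝ) < (P.L : ℝ) ^ k := pow_pos (by exact_mod_cast P.L_pos) k
  have hs' : ((s : ℕ) : ℝ) < (P.L : ℝ) ^ k := by have : ((s : ℕ) : ℝ) < ((P.L ^ k : ℕ) : ℝ) := by exact_mod_cast hs
                                                 push_cast at this; exact this
  have : 0 ≤ (P.L : ℝ) ^ k - (s : ℕ) := by linarith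
  positivity

/-- `ψ(s) ≤ 2` for `s < L^k` (`3(s+1)(n−s) ≤ (n+1)(n+2)`). [folklore] -/
theorem bubble_le_two (s : ℕ) (hs : s < P.L ^ k) :
    6 * (((s : ℕ) : ℝ) + 1) * ((P.L : ℝ) ^ k - (s : ℕ)) / (((P.L : ℝ) ^ k + 1) * ((P.L : ℝ) ^ k + 2)) ≤ 2 := by
  have hN : (0 : ℝ) < (P.L : ℝ) ^ k := pow_pos (by exact_mod_cast P.L_pos) k
  set N : ℝ := (P.L : ℝ) ^ k with hNdef
  set t : ℝ := ((s : ℕ) : ℝ) with ht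
  have ht0 : 0 ≤ t := by positivity
  have htN : t < N := by have : ((s : ℕ) : ℝ) < ((P.L ^ k : ℕ) : ℝ) := by exact_mod_cast hs
                         push_cast at this; exact this
  rw [div_le_iff₀ (by positivity)]
  nlinarith [sq_nonneg (N - 2 * t), mul_nonneg ht0 (le_of_lt (sub_pos.mpr htN))]

/-- Lipschitz on the block scale: `|ψ(s+1) − ψ(s)| ≤ 6·L^{−k}` for `s + 1 < L^k`. [folklore] -/
theorem bubble_lipschitz (s : ℕ) (hs : s + 1 < P.L ^ k) :
    |6 * ((((s + 1 : ℕ) : ℕ) : ℝ) + 1) * ((P.L : ℝ) ^ k - ((s + 1 : ℕ) : ℕ)) / (((P.L : ℝ) ^ k + 1) * ((P.L : ℝ) ^ k + 2))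
        - 6 * (((s : ℕ) : ℝ) + 1) * ((P.L : ℝ) ^ k - (s : ℕ)) / (((P.L : ℝ) ^ k + 1) * ((P.L : ℝ) ^ k + 2))| ≤ 6 * ((P.L : ℝ) ^ k)⁻¹ := by
  have hN : (0 : ℝ) < (P.L : ℝ) ^ k := pow_pos (by exact_mod_cast P.L_pos) k
  set N : ℝ := (P.L : ℝ) ^ k with hNdef
  set t : ℝ := ((s : ℕ) : ℝ) with ht
  have ht0 : 0 ≤ t := by positivity
  have htN : t + 1 < N := by have : (((s + 1 : ℕ) : ℕ) : ℝ) < ((P.L ^ k : ℕ) : ℝ) := by exact_mod_cast hs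
                             push_cast at this; linarith
  have hD : (0 : ℝ) < (N + 1) * (N + 2) := by positivity
  have hdiff : 6 * ((((s + 1 : ℕ) : ℕ) : ℝ) + 1) * (N - ((s + 1 : ℕ) : ℕ)) / ((N + 1) * (N + 2)) - 6 * (t + 1) * (N - t) / ((N + 1) * (N + 2))
      = 6 * (N - 2 * t - 2) / ((N + 1) * (N + 2)) := by
    push_cast; rw [← ht]; field_simp; ring
  rw [hdiff, abs_le]
  constructor
  · rw [show -(6 * N⁻¹) = (-6) / N by ring, div_le_div_iff₀ hN hD]
    nlinarith
  · rw [show 6 * N⁻¹ = 6 / N by ring, div_le_div_iff₀ hD hN]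
    nlinarith

/-- Lower face value: `ψ(0) ≤ 6·L^{−k}`. [folklore] -/
theorem bubble_face_zero :
    6 * ((((0 : ℕ) : ℕ) : ℝ) + 1) * ((P.L : ℝ) ^ k - ((0 : ℕ) : ℕ)) / (((P.L : ℝ) ^ k + 1) * ((P.L : ℝ) ^ k + 2)) ≤ 6 * ((P.L : ℝ) ^ k)⁻¹ := by
  have hN : (0 : ℝ) < (P.L : ℝ) ^ k := pow_pos (by exact_mod_cast P.L_pos) k
  set N : ℝ := (P.L : ℝ) ^ k with hNdef
  have hD : (0 : ℝ) < (N + 1) * (N + 2) := by positivity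
  push_cast
  rw [show 6 * N⁻¹ = 6 / N by ring, div_le_div_iff₀ hD hN]
  nlinarith

/-- Upper face value: `ψ(L^k − 1) ≤ 6·L^{−k}`. [folklore] -/
theorem bubble_face_last :
    6 * ((((P.L ^ k - 1 : ℕ) : ℕ) : ℝ) + 1) * ((P.L : ℝ) ^ k - ((P.L ^ k - 1 : ℕ) : ℕ)) / (((P.L : ℝ) ^ k + 1) * ((P.L : ℝ) ^ k + 2))
      ≤ 6 * ((P.L : ℝ) ^ k)⁻¹ := by
  have hN : (0 : ℝ) < (P.L : ℝ) ^ k := pow_pos (by exact_mod_cast P.L_pos) k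
  have hcast : (((P.L ^ k - 1 : ℕ) : ℕ) : ℝ) = (P.L : ℝ) ^ k - 1 := by
    have h1 : 1 ≤ P.L ^ k := Nat.one_le_pow _ _ P.L_pos
    rw [Nat.cast_sub h1]; push_cast; ring
  rw [hcast]
  set N : ℝ := (P.L : ℝ) ^ k with hNdef
  have hD : (0 : ℝ) < (N + 1) * (N + 2) := by positivity
  rw [show 6 * N⁻¹ = 6 / N by ring, div_le_div_iff₀ hD hN]
  nlinarith

end Profile

/-! ## §8 The smooth right inverse -/

section RightInverse

/-- **A `k`-UNIFORM RIGHT INVERSE OF THE STRAIGHT-LINE `k`-FOLD BLOCK AVERAGING WITH BOTH BOUNDS OF (46)** ([Balaban1985Variational] p. 285: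
«|HB| ≤ B₀(L^jη)⁻¹|B|, |∇HB| ≤ B₀(L^jη)⁻²|B|», at the flat background and the top scale `L^kη = 1`, for the main term `M_k` of the linearised
averaging): on every torus of `Setup` lying `k` block levels above `T^{(k)}` there is a LINEAR `H` (coarse bond fields → fine bond fields) with
`M_k(HZ) = Z`, `‖HZ‖_∞ ≤ 3·2^{d−1}‖Z‖_∞`, `‖HZ‖²_{ℓ²} ≤ 18·4^{d−1}L^{kd}‖Z‖²_{ℓ²}`, and the GRADIENT bounds `|HZ(b + e_ρ) − HZ(b)| ≤ 90·2^{d−1}L^{−k}‖Z‖_∞`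
(every direction `ρ`), `Σ_bΣ_ρ(HZ(b + e_ρ) − HZ(b))² ≤ 8100·d·4^{d−1}·L^{kd}L^{−2k}·‖Z‖²_{ℓ²}` — constants independent of `k` and of the volume
(`H` = modulated tent field ∘ `T⁻¹`, gen 3's `T` and `key_dominance`). [cite: Balaban1985Variational, (45)-(46) p.285] -/
theorem exists_smoothRightInverse_lineAvg (h : P.sitesPerDir 0 = P.L ^ k * P.sitesPerDir k) :
    ∃ H : (PBond P k → ℝ) →ₗ[ℝ] (PBond P 0 → ℝ), ∀ Z : PBond P k → ℝ,
      (∀ c : PBond P k, (((P.L : ℝ) ^ k) ^ P.d * (P.L : ℝ) ^ k)⁻¹ *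
          ∑ x ∈ univ.filter (fun x : Site P 0 => Site.proj k k x = c.src), ∑ t ∈ range (P.L ^ k),
            H Z ⟨(fun z : Site P 0 => z.shift c.dir)^[t] x, c.dir⟩ = Z c) ∧
      (∀ B : ℝ, (∀ c : PBond P k, |Z c| ≤ B) → ∀ b : PBond P 0, |H Z b| ≤ 3 * 2 ^ (P.d - 1) * B) ∧
      (∑ b : PBond P 0, (H Z b) ^ 2 ≤ 18 * 4 ^ (P.d - 1) * ((P.L : ℝ) ^ k) ^ P.d * ∑ c : PBond P k, (Z c) ^ 2) ∧
      (∀ B : ℝ, (∀ c : PBond P k, |Z c| ≤ B) → ∀ (b : PBond P 0) (ρ : Fin P.d),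
        |H Z ⟨b.src.shift ρ, b.dir⟩ - H Z b| ≤ 90 * 2 ^ (P.d - 1) * ((P.L : ℝ) ^ k)⁻¹ * B) ∧
      (∑ b : PBond P 0, ∑ ρ : Fin P.d, (H Z ⟨b.src.shift ρ, b.dir⟩ - H Z b) ^ 2
        ≤ 8100 * P.d * 4 ^ (P.d - 1) * ((P.L : ℝ) ^ k) ^ P.d * (((P.L : ℝ) ^ k) ^ 2)⁻¹ * ∑ c : PBond P k, (Z c) ^ 2) := by
  classical
  have hN : (0 : ℝ) < (P.L : ℝ) ^ k := pow_pos (by exact_mod_cast P.L_pos) k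
  -- the bubble profile
  let ψ : ℕ → ℝ := fun s => 6 * (((s : ℕ) : ℝ) + 1) * ((P.L : ℝ) ^ k - (s : ℕ)) / (((P.L : ℝ) ^ k + 1) * ((P.L : ℝ) ^ k + 2))
  have hψsum : ∑ s : Fin (P.L ^ k), ψ s = (P.L : ℝ) ^ k := bubble_sum P k
  have hψ0 : ∀ s : ℕ, s < P.L ^ k → 0 ≤ ψ s := fun s hs => bubble_nonneg P k s hs
  have hψ2 : ∀ s : ℕ, s < P.L ^ k → ψ s ≤ 2 := fun s hs => bubble_le_two P k s hs
  have hψL : ∀ s : ℕ, s + 1 < P.L ^ k → |ψ (s + 1) - ψ s| ≤ 6 * ((P.L : ℝ) ^ k)⁻¹ := fun s hs => bubble_lipschitz P k s hs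
  have hψf : ψ 0 ≤ 6 * ((P.L : ℝ) ^ k)⁻¹ := bubble_face_zero P k
  have hψl : ψ (P.L ^ k - 1) ≤ 6 * ((P.L : ℝ) ^ k)⁻¹ := bubble_face_last P k
  -- the modulated tent field (linear in `W`) and the normal operator
  let A : (PBond P k → ℝ) →ₗ[ℝ] (PBond P 0 → ℝ) :=
    { toFun := fun W b => (((P.L : ℝ) ^ k) ^ P.d * (P.L : ℝ) ^ k)⁻¹ *
        (((((b.src b.dir).val % P.L ^ k : ℕ) : ℝ) + 1) * W ⟨Site.proj k k b.src, b.dir⟩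
          + ((P.L ^ k - 1 - (b.src b.dir).val % P.L ^ k : ℕ) : ℝ) * W ⟨(Site.proj k k b.src).unshift b.dir, b.dir⟩)
        * ∏ ν ∈ univ.erase b.dir, ψ ((b.src ν).val % P.L ^ k)
      map_add' := fun W₁ W₂ => by funext b; simp only [Pi.add_apply]; ring
      map_smul' := fun a W => by funext b; simp only [Pi.smul_apply, smul_eq_mul, RingHom.id_apply]; ring }
  let α : ℝ := ∑ s : Fin (P.L ^ k), ((((s : ℕ) : ℝ) + 1) ^ 2 + (((P.L ^ k - 1 - (s : ℕ) : ℕ) : ℝ)) ^ 2)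
  let γ : ℝ := ∑ s : Fin (P.L ^ k), (((s : ℕ) : ℝ) + 1) * ((P.L ^ k - 1 - (s : ℕ) : ℕ) : ℝ)
  let D : ℝ := (((P.L : ℝ) ^ k) ^ P.d * (P.L : ℝ) ^ k)⁻¹ * ((((P.L ^ k : ℕ) : ℝ) ^ (P.d - 1)) *
      (((P.L : ℝ) ^ k) ^ P.d * (P.L : ℝ) ^ k)⁻¹)
  let T : (PBond P k → ℝ) →ₗ[ℝ] (PBond P k → ℝ) :=
    { toFun := fun W c => D * (α * W c + γ * W ⟨c.src.unshift c.dir, c.dir⟩ + γ * W ⟨runSite c.src c.dir 1, c.dir⟩)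
      map_add' := fun W₁ W₂ => by funext c; simp only [Pi.add_apply]; ring
      map_smul' := fun a W => by funext c; simp only [Pi.smul_apply, smul_eq_mul, RingHom.id_apply]; ring }
  have hD : 0 ≤ D := by positivity
  have hγ : 0 ≤ γ := tent_gamma_nonneg _
  have hK : (0 : ℝ) ≤ 3 * ((P.L : ℝ) ^ k) ^ P.d := by positivity
  have key : 1 ≤ 3 * ((P.L : ℝ) ^ k) ^ P.d * (D * (α - 2 * γ)) := key_dominance P k
  have hAdef : ∀ (W : PBond P k → ℝ) (b : PBond P 0), A W b = (((P.L : ℝ) ^ k) ^ P.d * (P.L : ℝ) ^ k)⁻¹ *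
      (((((b.src b.dir).val % P.L ^ k : ℕ) : ℝ) + 1) * W ⟨Site.proj k k b.src, b.dir⟩
        + ((P.L ^ k - 1 - (b.src b.dir).val % P.L ^ k : ℕ) : ℝ) * W ⟨(Site.proj k k b.src).unshift b.dir, b.dir⟩)
      * ∏ ν ∈ univ.erase b.dir, ψ ((b.src ν).val % P.L ^ k) := fun W b => rfl
  -- `M_k ∘ A = T`
  have hMA : ∀ (W : PBond P k → ℝ) (c : PBond P k), (((P.L : ℝ) ^ k) ^ P.d * (P.L : ℝ) ^ k)⁻¹ *
      ∑ x ∈ univ.filter (fun x : Site P 0 => Site.proj k k x = c.src), ∑ t ∈ range (P.L ^ k),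
        A W ⟨(fun z : Site P 0 => z.shift c.dir)^[t] x, c.dir⟩ = T W c := by
    intro W c
    rw [lineAvg_modField h ψ W (A W) (hAdef W) hψsum c]
    show _ = D * (α * W c + γ * W ⟨c.src.unshift c.dir, c.dir⟩ + γ * W ⟨runSite c.src c.dir 1, c.dir⟩)
    ring
  -- `T` is bijective
  have hinj : Function.Injective T := by
    intro W₁ W₂ hW
    have h0 : ∀ c, T (W₁ - W₂) c = (0 : PBond P k → ℝ) c := fun c => by rw [map_sub, hW, sub_self]
    have hle := tridiag_sup_le D α γ (W₁ - W₂) 0 hD hγ h0 (3 * ((P.L : ℝ) ^ k) ^ P.d) hK key (B := 0)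
      (fun c => by simp)
    funext c
    have hc := hle c
    rw [mul_zero] at hc
    have : (W₁ - W₂) c = 0 := abs_nonpos_iff.mp hc
    simpa [sub_eq_zero] using this
  have hsurj : Function.Surjective T := LinearMap.injective_iff_surjective.mp hinj
  let E : (PBond P k → ℝ) ≃ₗ[ℝ] (PBond P k → ℝ) := LinearEquiv.ofBijective T ⟨hinj, hsurj⟩
  refine ⟨A ∘ₗ E.symm.toLinearMap, fun Z => ?_⟩
  set W : PBond P k → ℝ := E.symm Z with hWdef
  have hTW : ∀ c, T W c = Z c := by
    intro c
    have hE : E W = Z := E.apply_symm_apply Z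
    rw [LinearEquiv.ofBijective_apply] at hE
    rw [hE]
  have hTW' : ∀ c : PBond P k, D * (α * W c + γ * W ⟨c.src.unshift c.dir, c.dir⟩ + γ * W ⟨runSite c.src c.dir 1, c.dir⟩) = Z c := hTW
  have hAW : (A ∘ₗ E.symm.toLinearMap) Z = A W := rfl
  rw [hAW]
  have hW2 := tridiag_l2_le D α γ W Z hD hγ hTW' (3 * ((P.L : ℝ) ^ k) ^ P.d) hK key
  have hpos : (0 : ℝ) < ((P.L : ℝ) ^ k) ^ P.d := by positivity
  refine ⟨fun c => by rw [hMA W c, hTW c], fun B hZ b => ?_, ?_, fun B hZ b ρ => ?_, ?_⟩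
  · -- sup bound
    have hW := tridiag_sup_le D α γ W Z hD hγ hTW' (3 * ((P.L : ℝ) ^ k) ^ P.d) hK key hZ
    have := modField_abs_le ψ W (A W) (hAdef W) hψ0 hψ2 hW b
    calc |A W b| ≤ 2 ^ (P.d - 1) * (((P.L : ℝ) ^ k) ^ P.d)⁻¹ * (3 * ((P.L : ℝ) ^ k) ^ P.d * B) := this
      _ = 3 * 2 ^ (P.d - 1) * B := by field_simp
  · -- ℓ² bound
    have hA2 := modField_sum_sq_le h ψ W (A W) (hAdef W) hψ0 hψ2
    calc ∑ b : PBond P 0, (A W b) ^ 2 ≤ 2 * 4 ^ (P.d - 1) * (((P.L : ℝ) ^ k) ^ P.d)⁻¹ * ∑ c : PBond P k, (W c) ^ 2 := hA2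
      _ ≤ 2 * 4 ^ (P.d - 1) * (((P.L : ℝ) ^ k) ^ P.d)⁻¹ * ((3 * ((P.L : ℝ) ^ k) ^ P.d) ^ 2 * ∑ c : PBond P k, (Z c) ^ 2) :=
          mul_le_mul_of_nonneg_left hW2 (by positivity)
      _ = 18 * 4 ^ (P.d - 1) * ((P.L : ℝ) ^ k) ^ P.d * ∑ c : PBond P k, (Z c) ^ 2 := by field_simp; ring
  · -- gradient, sup
    have hW := tridiag_sup_le D α γ W Z hD hγ hTW' (3 * ((P.L : ℝ) ^ k) ^ P.d) hK key hZ
    have := modField_shift_sub_abs_le_of_bound h ψ W (A W) (hAdef W) hψ0 hψ2 hψL hψf hψl hW b ρ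
    calc |A W ⟨b.src.shift ρ, b.dir⟩ - A W b| ≤ 30 * 2 ^ (P.d - 1) * (((P.L : ℝ) ^ k) ^ P.d * (P.L : ℝ) ^ k)⁻¹ * (3 * ((P.L : ℝ) ^ k) ^ P.d * B) := this
      _ = 90 * 2 ^ (P.d - 1) * ((P.L : ℝ) ^ k)⁻¹ * B := by field_simp; ring
  · -- gradient, ℓ²
    have hG := modField_grad_sum_sq_le h ψ W (A W) (hAdef W) hψ0 hψ2 hψL hψf hψl
    calc ∑ b : PBond P 0, ∑ ρ : Fin P.d, (A W ⟨b.src.shift ρ, b.dir⟩ - A W b) ^ 2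
        ≤ 900 * P.d * 4 ^ (P.d - 1) * ((((P.L : ℝ) ^ k) ^ P.d * (P.L : ℝ) ^ k)⁻¹) ^ 2 * ((P.L : ℝ) ^ k) ^ P.d * ∑ c : PBond P k, (W c) ^ 2 := hG
      _ ≤ 900 * P.d * 4 ^ (P.d - 1) * ((((P.L : ℝ) ^ k) ^ P.d * (P.L : ℝ) ^ k)⁻¹) ^ 2 * ((P.L : ℝ) ^ k) ^ P.d *
          ((3 * ((P.L : ℝ) ^ k) ^ P.d) ^ 2 * ∑ c : PBond P k, (Z c) ^ 2) := mul_le_mul_of_nonneg_left hW2 (by positivity)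
      _ = 8100 * P.d * 4 ^ (P.d - 1) * ((P.L : ℝ) ^ k) ^ P.d * (((P.L : ℝ) ^ k) ^ 2)⁻¹ * ∑ c : PBond P k, (Z c) ^ 2 := by field_simp; ring

/-- **THE SAME FOR THE ITERATED LINEAR BOND AVERAGE OF RECORD** `Q_k = LatticeFieldCalculus.bondAvgIter k` ([Balaban1984PropagatorsI] (1.18), identified
with the straight-line block average by `Prop7FlatCoercivity.bondAvgIter_eq_lineBlockAvg`), `k` in the standing range: a linear right inverse with the sup,
`ℓ²`, gradient-sup and gradient-`ℓ²` bounds, uniformly in `k` and in the volume. [cite: Balaban1985Variational, (45)-(46) p.285] -/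
theorem exists_smoothRightInverse_bondAvgIter (hk : k ≤ P.m + P.K) :
    ∃ H : (PBond P k → ℝ) →ₗ[ℝ] (PBond P 0 → ℝ), ∀ Z : VecField P k ℝ,
      bondAvgIter k (H Z) = Z ∧
      (∀ B : ℝ, (∀ c : PBond P k, |Z c| ≤ B) → ∀ b : PBond P 0, |H Z b| ≤ 3 * 2 ^ (P.d - 1) * B) ∧
      (∑ b : PBond P 0, (H Z b) ^ 2 ≤ 18 * 4 ^ (P.d - 1) * ((P.L : ℝ) ^ k) ^ P.d * ∑ c : PBond P k, (Z c) ^ 2) ∧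
      (∀ B : ℝ, (∀ c : PBond P k, |Z c| ≤ B) → ∀ (b : PBond P 0) (ρ : Fin P.d),
        |H Z ⟨b.src.shift ρ, b.dir⟩ - H Z b| ≤ 90 * 2 ^ (P.d - 1) * ((P.L : ℝ) ^ k)⁻¹ * B) ∧
      (∑ b : PBond P 0, ∑ ρ : Fin P.d, (H Z ⟨b.src.shift ρ, b.dir⟩ - H Z b) ^ 2
        ≤ 8100 * P.d * 4 ^ (P.d - 1) * ((P.L : ℝ) ^ k) ^ P.d * (((P.L : ℝ) ^ k) ^ 2)⁻¹ * ∑ c : PBond P k, (Z c) ^ 2) := by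
  obtain ⟨H, hH⟩ := exists_smoothRightInverse_lineAvg (Prop7FlatCoercivity.sitesPerDir_zero_eq_pow_mul hk)
  refine ⟨H, fun Z => ⟨?_, (hH Z).2⟩⟩
  funext c
  rw [Prop7FlatCoercivity.bondAvgIter_eq_lineBlockAvg_real hk]
  exact (hH Z).1 c

/-- **AT THE d = 3 CARRIER** of `T3Thm1Carrier.varProblem3 F n K` (fine torus `Site (F.P K) 0` of run `K`, `k = K − n` averaging levels down to the
comparison lattice): a linear right inverse `H` of `Q_{K−n}` on real bond fields with `‖HZ‖_∞ ≤ 12‖Z‖_∞`, `‖HZ‖²_{ℓ²} ≤ 288·L^{3(K−n)}‖Z‖²_{ℓ²}`,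
`|HZ(b + e_ρ) − HZ(b)| ≤ 360·L^{−(K−n)}‖Z‖_∞`, `Σ_bΣ_ρ|HZ(b + e_ρ) − HZ(b)|² ≤ 388800·L^{3(K−n)}·L^{−2(K−n)}‖Z‖²_{ℓ²}`, uniformly in `m`, `n`, `K` — the
linear core of the chart (47) of [Balaban1985Variational] Sect. C for the family's straight-line main term, now with the gradient half of (46).
[cite: Balaban1985Variational, (45)-(47) p.285] -/
theorem exists_smoothRightInverse_bondAvgIter_T3 (F : T3ContinuumYM3Torus.T3Family) (n K : ℕ) :
    ∃ H : (PBond (F.P K) (K - n) → ℝ) →ₗ[ℝ] (PBond (F.P K) 0 → ℝ), ∀ Z : VecField (F.P K) (K - n) ℝ,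
      bondAvgIter (K - n) (H Z) = Z ∧
      (∀ B : ℝ, (∀ c : PBond (F.P K) (K - n), |Z c| ≤ B) → ∀ b : PBond (F.P K) 0, |H Z b| ≤ 12 * B) ∧
      (∑ b : PBond (F.P K) 0, (H Z b) ^ 2 ≤ 288 * ((F.L : ℝ) ^ (K - n)) ^ 3 * ∑ c : PBond (F.P K) (K - n), (Z c) ^ 2) ∧
      (∀ B : ℝ, (∀ c : PBond (F.P K) (K - n), |Z c| ≤ B) → ∀ (b : PBond (F.P K) 0) (ρ : Fin 3),
        |H Z ⟨b.src.shift ρ, b.dir⟩ - H Z b| ≤ 360 * ((F.L : ℝ) ^ (K - n))⁻¹ * B) ∧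
      (∑ b : PBond (F.P K) 0, ∑ ρ : Fin 3, (H Z ⟨b.src.shift ρ, b.dir⟩ - H Z b) ^ 2
        ≤ 388800 * ((F.L : ℝ) ^ (K - n)) ^ 3 * (((F.L : ℝ) ^ (K - n)) ^ 2)⁻¹ * ∑ c : PBond (F.P K) (K - n), (Z c) ^ 2) := by
  obtain ⟨H, hH⟩ := exists_smoothRightInverse_bondAvgIter (P := F.P K) (k := K - n) (show K - n ≤ F.m + K by omega)
  refine ⟨H, fun Z => ⟨(hH Z).1, fun B hZ b => ?_, ?_, fun B hZ b ρ => ?_, ?_⟩⟩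
  · have := (hH Z).2.1 B hZ b; norm_num at this ⊢; exact this
  · have := (hH Z).2.2.1; norm_num at this ⊢; exact this
  · have := (hH Z).2.2.2.1 B hZ b ρ; norm_num at this ⊢; exact this
  · have := (hH Z).2.2.2.2; norm_num at this ⊢; exact this

end RightInverse

end Summit.QuantumFields.YangMills.Theorems.Prop7LineAvgSmoothRightInverse

end
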